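import Literature.Topology.FourManifolds.BasinSphere
import HarnessLib

/-!
# The basin setting: the corrected level conjugation and the extension `pull ∘ Ψ₁ ∘ push`

Topic `Literature/Topology/FourManifolds`; eleventh file of the endgame of the Torelli half of
Griffiths' handlebody theorem.  Everything here is **proved**.

For `B : BasinSetting g ξ`, `χ` as before, and a map `Θ` of the model space which preserves the
norm and is the cone over `sphereMap χ` on the shell `rad/2 ≤ ‖v‖ ≤ rad` (in dimension `3` such
a diffeomorphism `Θ` exists for every `χ`, `ConeRadialExtension.lean`):
* `BasinSetting.psi₁ χ Θ` — `ofChart ∘ Θ ∘ toChart` inside `{g < g p₀ + rad²}`, `psi χ` outside;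
  the two agree on the shell (`ofChart_Θ_toChart_eq_psi`), so `psi₁` is level-preserving,
  inverted by `psi₁ χ' Θ'`, **smooth at every point of `{g < mid}`** (`contMDiffAt_psi₁`: the
  apex `p₀` is now covered by the chart piece), and `psi₁ (push y) = push (χ y)` on `∂W`;
* `BasinSetting.ext χ Θ = pull ∘ psi₁ χ Θ ∘ push` — **restricts to `χ` on `∂W`** (`ext_coe`), is
  inverted by `ext χ' Θ'`, and is smooth (`contMDiff_ext`: `psi₁` preserves `{g ≤ L}` where
  `pull` is smooth); `BasinSetting.extDiffeomorph` — the extension as a self-diffeomorphism of `W`.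

## References

* J. Milnor, *Lectures on the h-cobordism theorem*, notes by L. Siebenmann and J. Sondow,
  Princeton Mathematical Notes (1965): Def. 3.1, proof of Thm. 3.4 (PDF pp. 11–13), Def. 3.9
  (PDF p. 16), Thm. 4.1 (PDF p. 22), proof of Thm. 5.4, Assertion 4 (PDF p. 29).
  [MilnorHCobordism1965]
* J. Milnor, *Morse theory* (1963), Thm. 3.1 and proof of Thm. 4.1 (p. 25). [Milnor1963]
* H. B. Griffiths, *Automorphisms of a 3-dimensional handlebody*, Abh. Math. Sem. Univ. Hamburg
  26 (1964), §§3–6. [GriffithsHB1964Handlebody]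
-/

open scoped Manifold ContDiff Topology
open Set Function Filter Metric

noncomputable section

namespace Literature.Topology.FourManifolds

open Cobordism FourManifolds.Flow

universe u

variable {n : ℕ} {W : Type u} [TopologicalSpace W] [T2Space W] [SecondCountableTopology W]
  [CompactSpace W] [ChartedSpace (EuclideanHalfSpace (n + 1)) W] [IsManifold (𝓡∂ (n + 1)) ∞ W]

/-! ### Assembly: the extension of the boundary diffeomorphism -/

namespace BasinSetting

attribute [local instance] fact_finrank_euclideanSpace_succ

variable {g : W → ℝ} {ξ : Π x : W, TangentSpace (𝓡∂ (n + 1)) x} (B : BasinSetting g ξ)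

/-- The level of the reference sphere of radius `rad`: `g p₀ + rad²`. [folklore] -/
def sphR : ℝ := g B.p₀ + B.rad ^ 2

/-- The level of the sphere of radius `rad / 2`. [folklore] -/
def sphR' : ℝ := g B.p₀ + (B.rad / 2) ^ 2

/-- The level `mid = (L + hi) / 2`, strictly between `L` and `hi`. [folklore] -/
def mid : ℝ := (B.L + B.hi) / 2

/-- `sphR' < sphR`. [folklore] -/
theorem sphR'_lt_sphR : B.sphR' < B.sphR := by
  unfold sphR sphR'; have := B.rad_pos; nlinarith

/-- `sphR < sph`. [folklore] -/
theorem sphR_lt_sph : B.sphR < B.sph := by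
  unfold sphR sph rad; have := B.r₀_pos; nlinarith

/-- `L < mid < hi`. [folklore] -/
theorem L_lt_mid : B.L < B.mid := by unfold mid; linarith [B.L_lt_hi]

/-- `mid < hi`. [folklore] -/
theorem mid_lt_hi : B.mid < B.hi := by unfold mid; linarith [B.L_lt_hi]

/-- `sph < mid`. [folklore] -/
theorem sph_lt_mid : B.sph < B.mid := B.sph_lt_L.trans B.L_lt_mid

/-- On `{g < sph}`, `g x < g p₀ + s²` iff `‖toChart x‖ < s` (`s ≥ 0`). [folklore] -/
theorem apply_lt_iff_norm_toChart_lt {x : W} (hx : g x ≤ B.sph) {s : ℝ} (hs : 0 ≤ s) :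
    g x < g B.p₀ + s ^ 2 ↔ ‖B.toChart x‖ < s := by
  rw [← pow_lt_pow_iff_left₀ (norm_nonneg _) hs two_ne_zero, B.norm_toChart_sq hx]
  constructor <;> intro h <;> linarith

variable [Nonempty (BoundaryManifold.boundaryData n W).carrier]
variable {B}
variable {χ : (𝓡∂ (n + 1)).boundary W → (𝓡∂ (n + 1)).boundary W}
  {hχ : ∀ y, χ y ∈ B.traces ↔ y ∈ B.traces}
  {Θ : EuclideanSpace ℝ (Fin (n + 1)) → EuclideanSpace ℝ (Fin (n + 1))}

variable (B) in
open scoped Classical in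
/-- **The corrected level conjugation `Ψ₁`**: inside the ball `{g < sphR}` the chart conjugate
of a map `Θ` of the model space (a diffeomorphism agreeing with the cone of `psi` on the shell),
outside it `psi χ`. [cite: GriffithsHB1964Handlebody, §§3–6] [cite: CerfDiffeoSphere1968, Ch. I §1, Lemme 2] -/
def psi₁ (χ : (𝓡∂ (n + 1)).boundary W → (𝓡∂ (n + 1)).boundary W)
    (Θ : EuclideanSpace ℝ (Fin (n + 1)) → EuclideanSpace ℝ (Fin (n + 1))) (x : W) : W :=
  if g x < B.sphR then B.ofChart (Θ (B.toChart x)) else B.psi χ x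

/-- `psi₁` inside the ball. [folklore] -/
theorem psi₁_of_lt {x : W} (hx : g x < B.sphR) : B.psi₁ χ Θ x = B.ofChart (Θ (B.toChart x)) := by
  unfold psi₁; rw [if_pos hx]

/-- `psi₁` outside the ball. [folklore] -/
theorem psi₁_of_le {x : W} (hx : B.sphR ≤ g x) : B.psi₁ χ Θ x = B.psi χ x := by
  unfold psi₁; rw [if_neg (not_lt.2 hx)]

section Cone

-- The hypotheses on `Θ`: it preserves the norm ...
variable (hΘn : ∀ v, ‖Θ v‖ = ‖v‖)
-- ... and it is the cone over `sphereMap χ` on the shell `rad / 2 ≤ t ≤ rad`.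
variable (hΘc : ∀ (t : ℝ) (u : Metric.sphere (0 : EuclideanSpace ℝ (Fin (n + 1))) 1), B.rad / 2 ≤ t → t ≤ B.rad →
    Θ (t • (u : EuclideanSpace ℝ (Fin (n + 1)))) =
      t • ((B.sphereMap χ hχ u : Metric.sphere (0 : EuclideanSpace ℝ (Fin (n + 1))) 1) : EuclideanSpace ℝ (Fin (n + 1))))

include hΘn in
/-- **`psi₁` preserves the levels.** [folklore] -/
theorem apply_psi₁ (hχ : ∀ y, χ y ∈ B.traces ↔ y ∈ B.traces) (x : W) : g (B.psi₁ χ Θ x) = g x := by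
  by_cases hx : g x < B.sphR
  · have hxs : g x ≤ B.sph := (hx.trans B.sphR_lt_sph).le
    have hv : ‖B.toChart x‖ ≤ B.r₀ := B.norm_toChart_le hxs
    rw [psi₁_of_lt hx, B.apply_ofChart (by rw [hΘn]; exact hv), hΘn, B.norm_toChart_sq hxs]; ring
  · rw [psi₁_of_le (not_lt.1 hx), apply_psi hχ]

include hΘc in
/-- **On the shell the chart conjugate of `Θ` is `psi`**: for `rad/2 ≤ ‖toChart x‖ ≤ rad`,
`ofChart (Θ (toChart x)) = psi χ x`. [cite: GriffithsHB1964Handlebody, §§3–6] -/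
theorem ofChart_Θ_toChart_eq_psi {x : W} (hx : g x ≤ B.sph) (h1 : B.rad / 2 ≤ ‖B.toChart x‖)
    (h2 : ‖B.toChart x‖ ≤ B.rad) : B.ofChart (Θ (B.toChart x)) = B.psi χ x := by
  set v := B.toChart x with hv
  have hv0 : v ≠ 0 := fun h => by rw [h, norm_zero] at h1; linarith [B.rad_pos]
  have hvn : 0 < ‖v‖ := norm_pos_iff.2 hv0
  set u : Metric.sphere (0 : EuclideanSpace ℝ (Fin (n + 1))) 1 := ⟨‖v‖⁻¹ • v, by
    rw [mem_sphere_zero_iff_norm, norm_smul, norm_inv, norm_norm, inv_mul_cancel₀ hvn.ne']⟩ with hu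
  have hvu : v = ‖v‖ • (u : EuclideanSpace ℝ (Fin (n + 1))) := by
    show v = ‖v‖ • (‖v‖⁻¹ • v); rw [smul_smul, mul_inv_cancel₀ hvn.ne', one_smul]
  have hxv : B.ofChart v = x := B.ofChart_toChart_of_apply_le hx
  rw [hvu, hΘc _ u h1 h2, ← coneFun_smul_coe hχ hvn h2 u, ← hvu, coneFun_def, hxv,
    B.ofChart_toChart_of_apply_le]
  rw [apply_psi hχ]; exact hx

include hΘc in
/-- **`psi₁ = psi` off the inner ball** `{g < sphR'}` (below `sph`). [folklore] -/
theorem psi₁_eq_psi_of_le {x : W} (hx : B.sphR' ≤ g x) : B.psi₁ χ Θ x = B.psi χ x := by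
  by_cases hx' : g x < B.sphR
  · rw [psi₁_of_lt hx']
    have hxs : g x ≤ B.sph := (hx'.trans B.sphR_lt_sph).le
    refine ofChart_Θ_toChart_eq_psi hΘc hxs ?_ ?_
    · have h := (B.apply_lt_iff_norm_toChart_lt hxs (by linarith [B.rad_pos] : (0 : ℝ) ≤ B.rad / 2)).not.1
        (by unfold sphR' at hx; exact not_lt.2 hx)
      exact not_lt.1 h
    · exact ((B.apply_lt_iff_norm_toChart_lt hxs B.rad_pos.le).1 hx').le
  · exact psi₁_of_le (not_lt.1 hx')

variable {χ' : (𝓡∂ (n + 1)).boundary W → (𝓡∂ (n + 1)).boundary W}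
  {Θ' : EuclideanSpace ℝ (Fin (n + 1)) → EuclideanSpace ℝ (Fin (n + 1))}

include hΘn in
/-- **`psi₁ χ' Θ'` inverts `psi₁ χ Θ` when `χ' ∘ χ = id` and `Θ' ∘ Θ = id`.** [folklore] -/
theorem psi₁_psi₁ (h : LeftInverse χ' χ) (hχ : ∀ y, χ y ∈ B.traces ↔ y ∈ B.traces)
    (hΘ : LeftInverse Θ' Θ) (x : W) : B.psi₁ χ' Θ' (B.psi₁ χ Θ x) = x := by
  have hlev := apply_psi₁ hΘn hχ x
  by_cases hx : g x < B.sphR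
  · have hxs : g x ≤ B.sph := (hx.trans B.sphR_lt_sph).le
    rw [psi₁_of_lt (by rw [hlev]; exact hx), psi₁_of_lt hx,
      B.toChart_ofChart (by rw [hΘn]; exact B.norm_toChart_le hxs), hΘ, B.ofChart_toChart_of_apply_le hxs]
  · rw [psi₁_of_le (by rw [hlev]; exact not_lt.1 hx), psi₁_of_le (not_lt.1 hx), psi_psi_of_leftInverse h hχ]

include hΘc in
/-- **`psi₁` is smooth at every point of `{g < mid}`**, for `Θ` smooth, `χ` smooth preserving the
traces and the identity off a compact `K ⊆ ∂W ∩ basin`: inside `{g < sphR}` it is the chart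
conjugate of `Θ`, on `{sphR' < g < mid}` it is `psi`, smooth there (`p₀` excluded).
[cite: GriffithsHB1964Handlebody, §§3–6] [cite: CerfDiffeoSphere1968, Ch. I §1, Lemme 2] -/
theorem contMDiffAt_psi₁ (hΘs : ContMDiff 𝓘(ℝ, EuclideanSpace ℝ (Fin (n + 1))) 𝓘(ℝ, EuclideanSpace ℝ (Fin (n + 1))) ∞ Θ)
    (hΘn : ∀ v, ‖Θ v‖ = ‖v‖)
    (hχs : ContMDiff (𝓡 n) (𝓡 n) ∞ χ) (hχ : ∀ y, χ y ∈ B.traces ↔ y ∈ B.traces)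
    {K : Set ((𝓡∂ (n + 1)).boundary W)} (hK : IsCompact K) (hKb : ∀ y ∈ K, (y : W) ∈ B.basin)
    (hχK : ∀ y, y ∉ K → χ y = y) {x : W} (hxm : g x < B.mid) :
    ContMDiffAt (𝓡∂ (n + 1)) (𝓡∂ (n + 1)) ∞ (B.psi₁ χ Θ) x := by
  have hgc : Continuous g := B.isMorseFunction.isMorse.contMDiff.continuous
  by_cases hx : g x < B.sphR
  · -- inside the ball: the chart conjugate of `Θ`
    have hxs : g x ≤ B.sph := (hx.trans B.sphR_lt_sph).le
    have hev : B.psi₁ χ Θ =ᶠ[𝓝 x] fun z => B.ofChart (Θ (B.toChart z)) := by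
      filter_upwards [(isOpen_lt hgc continuous_const).mem_nhds hx] with z hz
      exact psi₁_of_lt hz
    refine ContMDiffAt.congr_of_eventuallyEq ?_ hev
    have hnorm : ‖Θ (B.toChart x)‖ < B.r₀ := by
      rw [hΘn]; exact lt_of_lt_of_le ((B.apply_lt_iff_norm_toChart_lt hxs B.rad_pos.le).1 hx) B.rad_lt_r₀.le
    have h1 : ContMDiffAt (𝓡∂ (n + 1)) 𝓘(ℝ, EuclideanSpace ℝ (Fin (n + 1))) ∞ (Θ ∘ B.toChart) x :=
      hΘs.contMDiffAt.comp x (B.contMDiffAt_toChart (B.mem_source_of_apply_le hxs))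
    have h2 : ContMDiffAt (𝓡∂ (n + 1)) (𝓡∂ (n + 1)) ∞ (B.ofChart ∘ (Θ ∘ B.toChart)) x :=
      (contMDiffAt_ofChart hnorm).comp x h1
    exact h2
  · -- outside the inner ball: `psi`
    have hx' : B.sphR' < g x := B.sphR'_lt_sphR.trans_le (not_lt.1 hx)
    have hev : B.psi₁ χ Θ =ᶠ[𝓝 x] B.psi χ := by
      filter_upwards [(isOpen_lt continuous_const hgc).mem_nhds hx'] with z hz
      exact psi₁_eq_psi_of_le hΘc hz.le
    refine ContMDiffAt.congr_of_eventuallyEq ?_ hev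
    have hxp : x ≠ B.p₀ := fun h => by
      rw [h] at hx'; unfold sphR' at hx'; nlinarith [B.rad_pos]
    exact contMDiffAt_psi hχs hχ hK hKb hχK B.mid_lt_hi hxm hxp

end Cone

variable {χ' : (𝓡∂ (n + 1)).boundary W → (𝓡∂ (n + 1)).boundary W}
  {Θ' : EuclideanSpace ℝ (Fin (n + 1)) → EuclideanSpace ℝ (Fin (n + 1))}

/-- **`psi₁` on the push of a boundary point**: `psi₁ (push y) = push (χ y)` (for `χ` the
identity off `K ⊆ ∂W ∩ basin` and preserving the traces). [cite: GriffithsHB1964Handlebody, §§3–6] -/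
theorem psi₁_push_coe {K : Set ((𝓡∂ (n + 1)).boundary W)}
    (hKb : ∀ y ∈ K, (y : W) ∈ B.basin) (hχK : ∀ y, y ∉ K → χ y = y) (y : (𝓡∂ (n + 1)).boundary W) :
    B.psi₁ χ Θ (B.push (y : W)) = B.push (χ y : W) := by
  have hL : g (B.push (y : W)) = B.L := B.apply_push_coe y
  rw [psi₁_of_le (by rw [hL]; exact (B.sphR_lt_sph.trans B.sph_lt_L).le)]
  by_cases hy : (y : W) ∈ B.basin
  · have hpy : B.push (y : W) ∈ B.basin := by rw [mem_basin_iff, ← B.coe_mem_unstableSet_iff]; exact hy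
    have hd : B.push (y : W) ∈ B.dom := B.mem_dom_of_apply_eq_L hpy hL
    rw [psi_of_mem χ hd, conj_def, B.top_of_apply_eq hL, B.transport_push_coe, hL]
    have hL' : g (B.push (χ y : W)) = B.L := B.apply_push_coe _
    rw [levelProj_apply, B.hittingTime_L_eq (t := 0) (by rw [B.θ_zero]; exact hL'), B.θ_zero]
  · have hyK : y ∉ K := fun h => hy (hKb y h)
    have hd : B.push (y : W) ∉ B.dom := fun h => hy ((B.coe_mem_unstableSet_iff y B.p₀).2
      (by have := mem_basin_of_mem_dom h; exact this))
    rw [psi_of_not_mem χ hd, hχK y hyK]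

variable (B)

/-- **The extension** `Ψ = pull ∘ psi₁ ∘ push`. [cite: GriffithsHB1964Handlebody, §§3–6] -/
def ext (χ : (𝓡∂ (n + 1)).boundary W → (𝓡∂ (n + 1)).boundary W)
    (Θ : EuclideanSpace ℝ (Fin (n + 1)) → EuclideanSpace ℝ (Fin (n + 1))) (x : W) : W :=
  B.pull (B.psi₁ χ Θ (B.push x))

variable {B}

/-- **The extension restricts to `χ` on `∂W`.** [cite: GriffithsHB1964Handlebody, main theorem] -/
theorem ext_coe {K : Set ((𝓡∂ (n + 1)).boundary W)}
    (hKb : ∀ y ∈ K, (y : W) ∈ B.basin) (hχK : ∀ y, y ∉ K → χ y = y) (y : (𝓡∂ (n + 1)).boundary W) :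
    B.ext χ Θ (y : W) = (χ y : W) := by
  rw [ext, psi₁_push_coe hKb hχK, B.pull_push]

/-- **The extension of the inverse data inverts the extension.** [folklore] -/
theorem ext_ext (hΘn : ∀ v, ‖Θ v‖ = ‖v‖) (h : LeftInverse χ' χ) (hχ : ∀ y, χ y ∈ B.traces ↔ y ∈ B.traces)
    (hΘ : LeftInverse Θ' Θ) (x : W) : B.ext χ' Θ' (B.ext χ Θ x) = x := by
  rw [ext, ext, B.push_pull, psi₁_psi₁ hΘn h hχ hΘ, B.pull_push]
  rw [apply_psi₁ hΘn hχ]; exact B.apply_push_le x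

/-- **The extension is smooth.** [cite: GriffithsHB1964Handlebody, §§3–6] -/
theorem contMDiff_ext
    (hΘs : ContMDiff 𝓘(ℝ, EuclideanSpace ℝ (Fin (n + 1))) 𝓘(ℝ, EuclideanSpace ℝ (Fin (n + 1))) ∞ Θ)
    (hΘn : ∀ v, ‖Θ v‖ = ‖v‖)
    (hΘc : ∀ (t : ℝ) (u : Metric.sphere (0 : EuclideanSpace ℝ (Fin (n + 1))) 1), B.rad / 2 ≤ t → t ≤ B.rad →
      Θ (t • (u : EuclideanSpace ℝ (Fin (n + 1)))) =
        t • ((B.sphereMap χ hχ u : Metric.sphere (0 : EuclideanSpace ℝ (Fin (n + 1))) 1) : EuclideanSpace ℝ (Fin (n + 1))))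
    (hχs : ContMDiff (𝓡 n) (𝓡 n) ∞ χ)
    {K : Set ((𝓡∂ (n + 1)).boundary W)} (hK : IsCompact K) (hKb : ∀ y ∈ K, (y : W) ∈ B.basin)
    (hχK : ∀ y, y ∉ K → χ y = y) : ContMDiff (𝓡∂ (n + 1)) (𝓡∂ (n + 1)) ∞ (B.ext χ Θ) := by
  have h1 : ContMDiffOn (𝓡∂ (n + 1)) (𝓡∂ (n + 1)) ∞ (B.psi₁ χ Θ) {w | g w ≤ B.L} := fun w hw =>
    (contMDiffAt_psi₁ hΘc hΘs hΘn hχs hχ hK hKb hχK (lt_of_le_of_lt hw B.L_lt_mid)).contMDiffWithinAt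
  have h2 : MapsTo (B.psi₁ χ Θ) {w | g w ≤ B.L} {w | g w ≤ B.L} := fun w hw => by
    show g (B.psi₁ χ Θ w) ≤ B.L; rw [apply_psi₁ hΘn hχ]; exact hw
  have h3 : ContMDiffOn (𝓡∂ (n + 1)) (𝓡∂ (n + 1)) ∞ (B.pull ∘ B.psi₁ χ Θ) {w | g w ≤ B.L} :=
    B.contMDiffOn_pull.comp h1 h2
  have h4 : ContMDiffOn (𝓡∂ (n + 1)) (𝓡∂ (n + 1)) ∞ ((B.pull ∘ B.psi₁ χ Θ) ∘ B.push) univ :=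
    h3.comp B.contMDiff_push.contMDiffOn fun x _ => B.apply_push_le x
  exact contMDiffOn_univ.1 h4

variable (B)

/-- **The extension as a diffeomorphism of `W`**, for a pair of mutually inverse data
`(χ, Θ)`, `(χ', Θ')`. [cite: GriffithsHB1964Handlebody, main theorem] -/
def extDiffeomorph (χ χ' : (𝓡∂ (n + 1)).boundary W → (𝓡∂ (n + 1)).boundary W)
    (hχχ' : LeftInverse χ' χ) (hχ'χ : LeftInverse χ χ')
    (hχs : ContMDiff (𝓡 n) (𝓡 n) ∞ χ) (hχs' : ContMDiff (𝓡 n) (𝓡 n) ∞ χ')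
    (hχ : ∀ y, χ y ∈ B.traces ↔ y ∈ B.traces) (hχ' : ∀ y, χ' y ∈ B.traces ↔ y ∈ B.traces)
    (K : Set ((𝓡∂ (n + 1)).boundary W)) (hK : IsCompact K) (hKb : ∀ y ∈ K, (y : W) ∈ B.basin)
    (hχK : ∀ y, y ∉ K → χ y = y) (hχK' : ∀ y, y ∉ K → χ' y = y)
    (Θ Θ' : EuclideanSpace ℝ (Fin (n + 1)) → EuclideanSpace ℝ (Fin (n + 1)))
    (hΘΘ' : LeftInverse Θ' Θ) (hΘ'Θ : LeftInverse Θ Θ')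
    (hΘs : ContMDiff 𝓘(ℝ, EuclideanSpace ℝ (Fin (n + 1))) 𝓘(ℝ, EuclideanSpace ℝ (Fin (n + 1))) ∞ Θ)
    (hΘs' : ContMDiff 𝓘(ℝ, EuclideanSpace ℝ (Fin (n + 1))) 𝓘(ℝ, EuclideanSpace ℝ (Fin (n + 1))) ∞ Θ')
    (hΘn : ∀ v, ‖Θ v‖ = ‖v‖) (hΘn' : ∀ v, ‖Θ' v‖ = ‖v‖)
    (hΘc : ∀ (t : ℝ) (u : Metric.sphere (0 : EuclideanSpace ℝ (Fin (n + 1))) 1), B.rad / 2 ≤ t → t ≤ B.rad →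
      Θ (t • (u : EuclideanSpace ℝ (Fin (n + 1)))) =
        t • ((B.sphereMap χ hχ u : Metric.sphere (0 : EuclideanSpace ℝ (Fin (n + 1))) 1) : EuclideanSpace ℝ (Fin (n + 1))))
    (hΘc' : ∀ (t : ℝ) (u : Metric.sphere (0 : EuclideanSpace ℝ (Fin (n + 1))) 1), B.rad / 2 ≤ t → t ≤ B.rad →
      Θ' (t • (u : EuclideanSpace ℝ (Fin (n + 1)))) =
        t • ((B.sphereMap χ' hχ' u : Metric.sphere (0 : EuclideanSpace ℝ (Fin (n + 1))) 1) : EuclideanSpace ℝ (Fin (n + 1)))) :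
    W ≃ₘ⟮𝓡∂ (n + 1), 𝓡∂ (n + 1)⟯ W where
  toFun := B.ext χ Θ
  invFun := B.ext χ' Θ'
  left_inv := ext_ext hΘn hχχ' hχ hΘΘ'
  right_inv := ext_ext hΘn' hχ'χ hχ' hΘ'Θ
  contMDiff_toFun := contMDiff_ext hΘs hΘn hΘc hχs hK hKb hχK
  contMDiff_invFun := contMDiff_ext hΘs' hΘn' hΘc' hχs' hK hKb hχK'

end BasinSetting

end Literature.Topology.FourManifolds
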